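import Summits.BirchSwinnertonDyer.BirchSwinnertonDyer.Theorems.CycTangentCMCycTangentBoundPairSupply
import Summits.BirchSwinnertonDyer.Rank1Residual.X11b.InterpolationCharacterSupply
import Literature.NumberTheory.EllipticCurves.Rubin1991.TwoVariableMainConjecture
import HarnessLib

set_option linter.dupNamespace false
set_option autoImplicit false

/-!
# Crux `CycTangentCM.CycTangentBound` (stmt-BirchSwinnertonDyer-22628), refutation road: the
# `Ψ`-POWER LINE of a two-variable frame — a geometric progression of typed interpolation points
# through the trivial character, with the values the frame prescribes there

Lead seat `bsd-line-ctcm-p1` g0 (line `tangent-cone-parity`; card `Cruxes/CycTangentBound/Lines/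
tangent_cone_parity.md` § NEGATIVE ROAD, falsifier `…_falsifier.md` §2). Given a two-variable frame
`IsKatzMeasure₂ ι v v̄ S κ₁ κ₂ γ₁ γ₂ λ Ω δ Ω_p G` whose twist `λ` is algebraic of type `(−a, 0)`, `a > 0`,
unramified off `S` (the crux: `λ = ψ_A⁻¹`, `a = 1`), and ANY algebraic Hecke character `Ψ` of type
`(w, 0)` unramified everywhere (supplied for the nine CM fields by
`HeckeCharacter.exists_hasInfinityType_torsionOrder_unramified`, p585535, `w = w_K`), the interpolation
characters `ρ_n = Ψ^{−Mn}` with avatars `e ∘ χⁿ` through the pair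
(`CycTangentCMCycTangentBoundPairSupply.exists_isPAdicAvatarOf_pow_factorsThroughPair`, p584708) are
typed points of the frame: `λρ_n` has type `(−(a + wMn), 0)`, `j = 0 < m`, is unramified off `S`; so
the frame PRESCRIBES the value of `G` at `(xⁿ − 1, yⁿ − 1)`, `x = χ(γ₁)`, `y = χ(γ₂)` — a geometric
progression of points on one `ℤ_p`-line through the origin `(0,0)` (`n = 0`) — namely
`ι⁻¹(interpolationValue p v v̄ S (λΨ^{−Mn}) (a+wMn) 0 Ω δ L(λΨ^{−Mn}, 0)) · Ω_p^{a+wMn}` for every entire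
continuation `hL` (`exists_powerLine_hasValueAt₂`). With `λ = ψ_A⁻¹` these are the Hurwitz-type numbers
`e(t)` of the falsifier (`(1 − π^m/p)(1 − π̄^{−m}) Γ(m) L(ψ̄^m, m)/Ω^m · Ω_p^m`, `m = 1 + w_K M t`), whose
first few residues decide `λ̄` of the line through `IntSeries.isUnit_coeff_of_dualCertificate`
(p583552) and `curveSubst`/`monomialLine` (p582996/p583959). THEOREMS ONLY; nothing about any curve is
asserted; supports, does not close, stmt-BirchSwinnertonDyer-22628.

References: [deShalit1987] II.4.16 (49)–(50), II.4.17 (54) (the two-variable interpolation); [Weil1956]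
§1–§2; [Washington1997] §5.2, §13.1.
-/

noncomputable section

open scoped NumberField Classical
open NumberField IsDedekindDomain Field
  Literature.NumberTheory.GaloisRepresentations Literature.NumberTheory.EllipticCurves
open Summit.BirchSwinnertonDyer.Rank1Residual.X11b
open Summit.BirchSwinnertonDyer.Rank1Residual.X11b.Three.LambdaSupply
open Summit.BirchSwinnertonDyer.Rank1Residual.X11b.LambdaSupply
open Summit.BirchSwinnertonDyer.BirchSwinnertonDyer.Theorems.CycTangentCMCycTangentBoundPairSupply

namespace Summit.BirchSwinnertonDyer.BirchSwinnertonDyer.Theorems.CycTangentCMCycTangentBoundPowerLine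

variable {K : Type} [Field K] [NumberField K] {p : ℕ} [Fact p.Prime]

/-- **The `Ψ`-power line of a two-variable frame.** See the module docstring: for a frame `G` with
twist `λ` of type `(−a, 0)`, `a > 0`, unramified off `S`, and `Ψ` of type `(w, 0)` unramified
everywhere, there are `M > 0` and `x, y ∈ ℂ_p` (the values `χ(γ₁), χ(γ₂)` of one continuous character
through the pair) such that for every `n` and every entire continuation of `L(λΨ^{−Mn}, s)` the frame
prescribes `G(xⁿ − 1, yⁿ − 1) = ι⁻¹(interpolationValue … (λΨ^{−Mn}) (a + wMn) 0 …) · Ω_p^{a + wMn}`.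
[cite: deShalit1987, II.4.16 (49)–(50) and II.4.17 (54) (p. 76–78)] [cite: Weil1956, §1–§2] -/
theorem exists_powerLine_hasValueAt₂ (ι : PadicAlgCl p ≃+* ℂ)
    (hK : Module.finrank ℚ K = 2) (himag : ∀ w : InfinitePlace K, w.IsComplex)
    {v vbar : HeightOneSpectrum (𝓞 K)} {S : Finset (HeightOneSpectrum (𝓞 K))}
    {κ₁ κ₂ : ZpExtension K p} {γ₁ γ₂ : absoluteGaloisGroup K}
    (hpair : ZpExtension.IsTopGeneratorPair κ₁ κ₂ γ₁ γ₂)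
    {lam : HeckeCharacter K} {Ω δ : ℂ} {Ωp : ℂ_[p]}
    {G : PowerSeries (PowerSeries (PadicComplexInt p))}
    (hG : IsKatzMeasure₂ ι v vbar S κ₁ κ₂ γ₁ γ₂ lam Ω δ Ωp G)
    {a : ℕ} (ha : 0 < a) (hlam : lam.HasInfinityType (fun _ ↦ -(a : ℤ)) (fun _ ↦ 0))
    (hlamS : ∀ w : HeightOneSpectrum (𝓞 K), w ∉ S → lam.IsUnramifiedAt w)
    {Ψ : HeckeCharacter K} {w : ℕ} (hΨt : Ψ.HasInfinityType (fun _ ↦ (w : ℤ)) (fun _ ↦ 0))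
    (hΨu : ∀ u : HeightOneSpectrum (𝓞 K), Ψ.IsUnramifiedAt u) :
    ∃ (M : ℕ) (x y : ℂ_[p]), 0 < M ∧
      ∀ (n : ℕ) (hL : LFunction.HasEntireContinuation (heckeLFunction (lam * Ψ⁻¹ ^ (M * n)))),
        IntSeries.HasValueAt₂ G (x ^ n - 1) (y ^ n - 1)
          (((ι.symm (DeShalit1987.interpolationValue p v vbar S (lam * Ψ⁻¹ ^ (M * n))
              (a + w * (M * n)) 0 Ω δ (hL.continuation 0)) : PadicAlgCl p) : ℂ_[p]) *
            Ωp ^ (a + w * (M * n))) := by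
  set e := (FramedRep.unitsContinuousMulEquivOfUnique (Fin 1) (PadicAlgCl p) :
    (PadicAlgCl p)ˣ →ₜ* GL (Fin 1) (PadicAlgCl p)) with he
  -- the interpolation characters `Ψ^{-Mn}` through the pair
  have hΨ'a : Ψ⁻¹.IsAlgebraic :=
    (HeckeCharacter.isAlgebraic_iff_exists_hasInfinityType _).mpr ⟨_, _, hΨt.inv⟩
  have hΨ'u : ∀ u : HeightOneSpectrum (𝓞 K), ((p : ℕ) : 𝓞 K) ∉ u.asIdeal → Ψ⁻¹.IsUnramifiedAt u :=
    fun u _ ↦ (hΨu u).inv'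
  obtain ⟨M, χ, hM, hall⟩ :=
    exists_isPAdicAvatarOf_pow_factorsThroughPair ι hK himag hΨ'a hΨ'u hpair
  refine ⟨M, avatarValueAt (e.comp χ) γ₁, avatarValueAt (e.comp χ) γ₂, hM, fun n hL ↦ ?_⟩
  obtain ⟨hav, hfac⟩ := hall n
  -- infinity type and ramification of `λ Ψ^{-Mn}`
  have htype : (lam * Ψ⁻¹ ^ (M * n)).HasInfinityType (fun _ ↦ -((a + w * (M * n) : ℕ) : ℤ))
      (fun _ ↦ ((0 : ℕ) : ℤ)) := by
    have h1 := (hΨt.inv).zpow' ((M * n : ℕ) : ℤ)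
    rw [zpow_natCast] at h1
    have h2 := hlam.mul' h1
    convert h2 using 2 <;>
      simp only [Pi.add_apply, Pi.smul_apply, Pi.neg_apply, smul_eq_mul] <;> push_cast <;> ring
  have hunr : ∀ u : HeightOneSpectrum (𝓞 K), u ∉ S → u ≠ vbar → (lam * Ψ⁻¹ ^ (M * n)).IsUnramifiedAt u :=
    fun u hu _ ↦ (hlamS u hu).mul' (isUnramifiedAt_pow' ((hΨu u).inv') _)
  have hjm : 0 < a + w * (M * n) := by omega
  have h := hG.hasValueAt₂ hav hfac hjm htype hunr hL
  rw [avatarValueAt_unitsChar_pow, avatarValueAt_unitsChar_pow, add_zero] at h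
  exact h

end Summit.BirchSwinnertonDyer.BirchSwinnertonDyer.Theorems.CycTangentCMCycTangentBoundPowerLine

end
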